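import Literature.Analysis.FluidPDE.DriftHeatGaussianBounds
import Mathlib.Analysis.InnerProductSpace.PiL2
import Mathlib.MeasureTheory.Integral.Bochner.Basic

/-!
# Crux `AdaptedKernelExists` (stmt-NavierStokesRegularity-2956), line `nash-entropy-last-block`:
  the CONVOLUTION BOUND for STUB `stub_upperOfMoments`

Helper file (lands `--supports stmt-NavierStokesRegularity-2956`) for the registered stub
`stub_upperOfMoments` of the line's skeleton (Gaussian upper bound on the last block from
exponential moments). This file turns the exponential-moment bound of a density `g ≥ 0` on `ℝ³`,
`∫ e^{⟨α, z − x₀⟩} g(z) dz ≤ exp(ν‖α‖² h/2 + 2C‖α‖√(h/2))` for all `α`, into the Gaussian bound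
`∫ g(z) k₊(σ, x − z) dz ≤ C₁ h^{-3/2} e^{−‖x−x₀‖²/(32νh)}` for the supersolution kernel
`k₊ = driftKernel 1 (C/(ν√(h/2)))` at ages `σ ∈ [νh/2, νh]`, with `C₁ = C₁(ν, C)`
(`stub_upperOfMoments_convolution`, a registered sub-goal of the crux item):

* `upperOfMoments_exp_norm_le_sum`: `e^{θ‖w‖} ≤ Σᵢ (e^{2θwᵢ} + e^{−2θwᵢ})` on `ℝ³`
  (`‖w‖ ≤ 2 maxᵢ |wᵢ|`);
* `upperOfMoments_norm_moment`: hence the exponential moment of the norm,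
  `∫ e^{θ‖z−x₀‖} g ≤ 6 Φ(2θ)`, from the moments in the six directions `±2θ eᵢ`;
* `upperOfMoments_kernel_pointwise`: `k₊(σ, y) ≤ (2πν)^{-3/2} h^{-3/2} e^{17C²/ν + 9/2}
  e^{−‖y‖²/(8νh)}` for `σ ∈ [νh/2, νh]` (`driftKernel_le_kSupTail`; the tilt is `h`-free);
* `stub_upperOfMoments_convolution`: `e^{−‖x−z‖²/(8νh)} ≤ e^{2νhθ² − θ‖x−x₀‖} e^{θ‖z−x₀‖}`,
  the moment bound, and the choice `θ = ‖x − x₀‖/(8νh)`.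
-/

noncomputable section

open MeasureTheory Set Filter Topology Metric Function Real
open Literature.Analysis.FluidPDE

namespace Summit.NavierStokesRegularity.NavierStokesRegularity.Theorems.AdaptedKernelExists.NashEntropyLastBlock

/-! ### Exponential moment of the norm from the coordinate moments (dimension three) -/

/-- On `ℝ³`, `e^{θ‖w‖} ≤ Σᵢ (e^{2θwᵢ} + e^{−2θwᵢ})` for `θ ≥ 0`: some coordinate has
`2|wᵢ| ≥ ‖w‖` (else `‖w‖² = Σ wᵢ² < ¾‖w‖²`). -/
theorem upperOfMoments_exp_norm_le_sum {θ : ℝ} (hθ : 0 ≤ θ) (w : EuclideanSpace ℝ (Fin 3)) :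
    Real.exp (θ * ‖w‖) ≤ ∑ i, (Real.exp (2 * θ * w i) + Real.exp (-(2 * θ * w i))) := by
  obtain ⟨j, hj⟩ : ∃ j, ‖w‖ ≤ 2 * |w j| := by
    by_contra hcon
    push Not at hcon
    have hsq : ‖w‖ ^ 2 = w 0 ^ 2 + w 1 ^ 2 + w 2 ^ 2 := by
      rw [EuclideanSpace.real_norm_sq_eq, Fin.sum_univ_three]
    have h4 : ∀ i, 4 * w i ^ 2 < ‖w‖ ^ 2 := fun i => by
      have h2 : (2 * |w i|) ^ 2 < ‖w‖ ^ 2 := pow_lt_pow_left₀ (hcon i) (by positivity) two_ne_zero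
      nlinarith [sq_abs (w i)]
    nlinarith [h4 0, h4 1, h4 2, sq_nonneg ‖w‖]
  have h1 : Real.exp (θ * ‖w‖) ≤ Real.exp (2 * θ * |w j|) :=
    Real.exp_le_exp.2 (by nlinarith [mul_le_mul_of_nonneg_left hj hθ])
  have h2 : Real.exp (2 * θ * |w j|) ≤ Real.exp (2 * θ * w j) + Real.exp (-(2 * θ * w j)) := by
    rcases abs_choice (w j) with h | h <;> rw [h]
    · linarith [Real.exp_pos (-(2 * θ * w j))]
    · rw [mul_neg]; linarith [Real.exp_pos (2 * θ * w j)]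
  calc Real.exp (θ * ‖w‖) ≤ Real.exp (2 * θ * w j) + Real.exp (-(2 * θ * w j)) := h1.trans h2
    _ ≤ ∑ i, (Real.exp (2 * θ * w i) + Real.exp (-(2 * θ * w i))) :=
        Finset.single_le_sum (f := fun i => Real.exp (2 * θ * w i) + Real.exp (-(2 * θ * w i)))
          (fun i _ => by positivity) (Finset.mem_univ j)

/-- **Exponential moment of the norm.** If `g ≥ 0` on `ℝ³` has
`∫ e^{⟨α, z − x₀⟩} g ≤ Φ(‖α‖)` (with integrability) for every `α`, then for `θ ≥ 0` the moment
`∫ e^{θ‖z − x₀‖} g(z) dz` exists and is at most `6 Φ(2θ)` (the six directions `α = ±2θ eᵢ`). -/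
theorem upperOfMoments_norm_moment {θ : ℝ} {x₀ : EuclideanSpace ℝ (Fin 3)}
    {g : EuclideanSpace ℝ (Fin 3) → ℝ} {Φ : ℝ → ℝ} (hθ : 0 ≤ θ) (hg0 : ∀ z, 0 ≤ g z)
    (hmom : ∀ α : EuclideanSpace ℝ (Fin 3),
      Integrable (fun z => Real.exp (inner ℝ α (z - x₀)) * g z) ∧
        ∫ z, Real.exp (inner ℝ α (z - x₀)) * g z ≤ Φ ‖α‖) :
    Integrable (fun z => Real.exp (θ * ‖z - x₀‖) * g z) ∧
      ∫ z, Real.exp (θ * ‖z - x₀‖) * g z ≤ 6 * Φ (2 * θ) := by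
  have hinner : ∀ (i : Fin 3) (c : ℝ) (w : EuclideanSpace ℝ (Fin 3)),
      inner ℝ (EuclideanSpace.single i c) w = c * w i := by
    intro i c w
    rw [EuclideanSpace.inner_single_left]
    simp
  have hnorm : ∀ (i : Fin 3) (c : ℝ),
      ‖(EuclideanSpace.single i c : EuclideanSpace ℝ (Fin 3))‖ = |c| := by
    intro i c
    rw [PiLp.norm_single, Real.norm_eq_abs]
  have h2θ : |2 * θ| = 2 * θ := abs_of_nonneg (by positivity)
  have h2θ' : |-(2 * θ)| = 2 * θ := by rw [abs_neg, h2θ]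
  -- the six coordinate moments
  obtain ⟨F, hF⟩ : ∃ F : Fin 3 → EuclideanSpace ℝ (Fin 3) → ℝ, F = fun i z =>
      Real.exp (inner ℝ (EuclideanSpace.single i (2 * θ)) (z - x₀)) * g z +
        Real.exp (inner ℝ (EuclideanSpace.single i (-(2 * θ))) (z - x₀)) * g z := ⟨_, rfl⟩
  have hFi : ∀ i, Integrable (F i) := fun i => by
    rw [hF]
    exact (hmom (EuclideanSpace.single i (2 * θ))).1.add
      (hmom (EuclideanSpace.single i (-(2 * θ)))).1
  have hFint : ∀ i, ∫ z, F i z ≤ 2 * Φ (2 * θ) := fun i => by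
    rw [hF]
    have e1 := (hmom (EuclideanSpace.single i (2 * θ))).2
    have e2 := (hmom (EuclideanSpace.single i (-(2 * θ)))).2
    rw [hnorm, h2θ] at e1
    rw [hnorm, h2θ'] at e2
    have := integral_add (hmom (EuclideanSpace.single i (2 * θ))).1
      (hmom (EuclideanSpace.single i (-(2 * θ)))).1
    rw [this]
    linarith
  have hsum : Integrable fun z => ∑ i, F i z := integrable_finsetSum _ fun i _ => hFi i
  -- pointwise domination
  have hpt : ∀ z, Real.exp (θ * ‖z - x₀‖) * g z ≤ ∑ i, F i z := fun z => by
    have h1 := mul_le_mul_of_nonneg_right (upperOfMoments_exp_norm_le_sum hθ (z - x₀)) (hg0 z)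
    rw [Finset.sum_mul] at h1
    refine h1.trans (le_of_eq (Finset.sum_congr rfl fun i _ => ?_))
    rw [hF]
    simp only [hinner, add_mul, neg_mul]
  -- measurability of the moment integrand
  have hgm : AEStronglyMeasurable g volume := by
    have h0 := (hmom 0).1
    simp only [inner_zero_left, Real.exp_zero, one_mul] at h0
    exact h0.aestronglyMeasurable
  have hm : AEStronglyMeasurable (fun z => Real.exp (θ * ‖z - x₀‖) * g z) volume :=
    (Continuous.aestronglyMeasurable (by fun_prop)).mul hgm
  have hint : Integrable (fun z => Real.exp (θ * ‖z - x₀‖) * g z) :=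
    hsum.mono' hm (Eventually.of_forall fun z => by
      rw [Real.norm_of_nonneg (mul_nonneg (Real.exp_pos _).le (hg0 z))]
      exact hpt z)
  refine ⟨hint, ?_⟩
  calc ∫ z, Real.exp (θ * ‖z - x₀‖) * g z ≤ ∫ z, ∑ i, F i z := integral_mono hint hsum hpt
    _ = ∑ i, ∫ z, F i z := integral_finsetSum _ fun i _ => hFi i
    _ ≤ ∑ _i : Fin 3, 2 * Φ (2 * θ) := Finset.sum_le_sum fun i _ => hFint i
    _ = 6 * Φ (2 * θ) := by
        rw [Finset.sum_const, Finset.card_univ, Fintype.card_fin, nsmul_eq_mul]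
        push_cast
        ring

/-! ### The supersolution kernel at ages comparable to `νh` -/

/-- **Pointwise bound of the supersolution kernel on the last block.** For `σ ∈ [νh/2, νh]` and
the drift bound `A = C/(ν√(h/2))`:
`k₊(σ, y) ≤ (2πν)^{-3/2} h^{-3/2} e^{17C²/ν + 9/2} e^{−‖y‖²/(8νh)}` (`driftKernel_le_kSupTail` at
radius `‖y‖`; the tilt `4A²σ + 9A√σ` is `h`-free: `A²σ ≤ 2C²/ν`, `A√σ ≤ (A²σ + 1)/2`). -/
theorem upperOfMoments_kernel_pointwise {ν C h σ : ℝ} (hν : 0 < ν) (hC : 0 ≤ C) (hh : 0 < h)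
    (hσ1 : ν * (h / 2) ≤ σ) (hσ2 : σ ≤ ν * h) (y : EuclideanSpace ℝ (Fin 3)) :
    driftKernel 1 (C / Real.sqrt (h / 2) / ν) σ y ≤
      (2 * π * ν) ^ (-(3:ℝ) / 2) * h ^ (-(3:ℝ) / 2) * Real.exp (17 * C ^ 2 / ν + 9 / 2) *
        Real.exp (-‖y‖ ^ 2 / (8 * (ν * h))) := by
  have hσ : 0 < σ := lt_of_lt_of_le (by positivity) hσ1
  obtain ⟨u, hu, hu2⟩ : ∃ u, 0 < u ∧ u ^ 2 = h / 2 :=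
    ⟨Real.sqrt (h / 2), Real.sqrt_pos.2 (half_pos hh), Real.sq_sqrt (half_pos hh).le⟩
  have hsq : Real.sqrt (h / 2) = u := by rw [← hu2, Real.sqrt_sq hu.le]
  rw [hsq]
  obtain ⟨A, hA⟩ : ∃ A : ℝ, A = C / u / ν := ⟨_, rfl⟩
  rw [← hA]
  have hA0 : 0 ≤ A := by rw [hA]; positivity
  have h1 := driftKernel_le_kSupTail (E := EuclideanSpace ℝ (Fin 3)) (ε := 1) (A := A)
    (by norm_num) hA0 hσ (norm_nonneg y) le_rfl
  simp only [finrank_euclideanSpace_fin, Nat.cast_ofNat] at h1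
  rw [kSupTail] at h1
  -- the tilt
  -- (`linarith` atoms: keep `C ^ 2 / ν` as the only non-linear symbol)
  have hA2 : A ^ 2 * σ ≤ 2 * (C ^ 2 / ν) := by
    have e : A ^ 2 * (ν * h) = 2 * (C ^ 2 / ν) := by
      rw [hA, show h = 2 * u ^ 2 by linarith]
      field_simp
    calc A ^ 2 * σ ≤ A ^ 2 * (ν * h) := mul_le_mul_of_nonneg_left hσ2 (sq_nonneg A)
      _ = 2 * (C ^ 2 / ν) := e
  have hAs : A * Real.sqrt σ ≤ C ^ 2 / ν + 1 / 2 := by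
    have hs : (A * Real.sqrt σ) ^ 2 = A ^ 2 * σ := by rw [mul_pow, Real.sq_sqrt hσ.le]
    nlinarith [sq_nonneg (A * Real.sqrt σ - 1)]
  have htilt : 2 * A ^ 2 * σ + A * Real.sqrt σ +
      (2 * (3 + 1) * A * Real.sqrt σ + 2 * A ^ 2 * σ) ≤ 17 * C ^ 2 / ν + 9 / 2 := by
    rw [mul_div_assoc]
    linarith
  -- the normalisation
  have hN : (4 * π * σ) ^ (-3 / 2 : ℝ) ≤ (2 * π * ν) ^ (-(3:ℝ) / 2) * h ^ (-(3:ℝ) / 2) := by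
    rw [← Real.mul_rpow (by positivity) hh.le, show (-3 / 2 : ℝ) = -(3:ℝ) / 2 by norm_num]
    exact Real.rpow_le_rpow_of_nonpos (by positivity) (by nlinarith [Real.pi_pos]) (by norm_num)
  -- the Gaussian factor
  have hE : Real.exp (-‖y‖ ^ 2 / (8 * σ)) ≤ Real.exp (-‖y‖ ^ 2 / (8 * (ν * h))) := by
    refine Real.exp_le_exp.2 ?_
    rw [neg_div, neg_div, neg_le_neg_iff]
    exact div_le_div_of_nonneg_left (sq_nonneg _) (by positivity) (by nlinarith)
  have hP : 0 ≤ (2 * π * ν) ^ (-(3:ℝ) / 2) * h ^ (-(3:ℝ) / 2) := by positivity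
  calc driftKernel 1 A σ y
      ≤ (4 * π * σ) ^ (-3 / 2 : ℝ) * Real.exp (-‖y‖ ^ 2 / (8 * σ)) *
          Real.exp (2 * A ^ 2 * σ + A * Real.sqrt σ +
            (2 * (3 + 1) * A * Real.sqrt σ + 2 * A ^ 2 * σ)) := h1
    _ ≤ ((2 * π * ν) ^ (-(3:ℝ) / 2) * h ^ (-(3:ℝ) / 2)) * Real.exp (-‖y‖ ^ 2 / (8 * (ν * h))) *
          Real.exp (17 * C ^ 2 / ν + 9 / 2) := by
        gcongr
    _ = _ := by ring

/-! ### The registered sub-goal: the convolution bound -/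

/-- **Registered sub-goal `stub_upperOfMoments_convolution`** (the moments-to-Gaussian step of
STUB `stub_upperOfMoments`). For `g ≥ 0` on `ℝ³` with the exponential-moment bound
`∫ e^{⟨α, z − x₀⟩} g ≤ exp(ν‖α‖² h/2 + 2C‖α‖√(h/2))` for all `α`, and an age `σ ∈ [νh/2, νh]`:
`∫ g(z) k₊(σ, x − z) dz ≤ 6 (2πν)^{-3/2} e^{18C²/ν + 9/2} h^{-3/2} e^{−‖x−x₀‖²/(32νh)}`,
`k₊ = driftKernel 1 (C/(ν√(h/2)))`. Proof: the pointwise kernel bound, then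
`e^{−‖x−z‖²/(8νh)} ≤ e^{2νhθ² − θ‖x−x₀‖} e^{θ‖z−x₀‖}`, the norm moment `≤ 6 e^{2νhθ² + 4Cθ√(h/2)}`
and `θ = ‖x − x₀‖/(8νh)`. -/
theorem stub_upperOfMoments_convolution :
    ∀ (ν C h σ : ℝ) (x₀ x : EuclideanSpace ℝ (Fin 3)) (g : EuclideanSpace ℝ (Fin 3) → ℝ), 0 < ν → 0 ≤ C → 0 < h → ν * (h / 2) ≤ σ → σ ≤ ν * h → (∀ z, 0 ≤ g z) → (∀ α : EuclideanSpace ℝ (Fin 3), Integrable (fun z => Real.exp (inner ℝ α (z - x₀)) * g z) ∧ ∫ z, Real.exp (inner ℝ α (z - x₀)) * g z ≤ Real.exp (ν * ‖α‖ ^ 2 * (h / 2) + 2 * C * ‖α‖ * Real.sqrt (h / 2))) → ∫ z, g z * driftKernel 1 (C / Real.sqrt (h / 2) / ν) σ (x - z) ≤ 6 * (2 * Real.pi * ν) ^ (-(3:ℝ) / 2) * Real.exp (18 * C ^ 2 / ν + 9 / 2) * h ^ (-(3:ℝ) / 2) * Real.exp (-(‖x - x₀‖ ^ 2) / (32 *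 ν * h)) := by
  intro ν C h σ x₀ x g hν hC hh hσ1 hσ2 hg0 hmom
  have hσ : 0 < σ := lt_of_lt_of_le (by positivity) hσ1
  obtain ⟨u, hu, hu2⟩ : ∃ u, 0 < u ∧ u ^ 2 = h / 2 :=
    ⟨Real.sqrt (h / 2), Real.sqrt_pos.2 (half_pos hh), Real.sq_sqrt (half_pos hh).le⟩
  have hsq : Real.sqrt (h / 2) = u := by rw [← hu2, Real.sqrt_sq hu.le]
  obtain ⟨r, hr⟩ : ∃ r : ℝ, r = ‖x - x₀‖ := ⟨_, rfl⟩
  have hr0 : 0 ≤ r := by rw [hr]; exact norm_nonneg _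
  obtain ⟨θ, hθ⟩ : ∃ θ : ℝ, θ = r / (8 * (ν * h)) := ⟨_, rfl⟩
  have hθ0 : 0 ≤ θ := by rw [hθ]; positivity
  obtain ⟨P, hP⟩ : ∃ P : ℝ, P = (2 * π * ν) ^ (-(3:ℝ) / 2) * h ^ (-(3:ℝ) / 2) *
      Real.exp (17 * C ^ 2 / ν + 9 / 2) := ⟨_, rfl⟩
  have hP0 : 0 ≤ P := by rw [hP]; positivity
  -- pointwise bound of the integrand
  have hpt : ∀ z, g z * driftKernel 1 (C / Real.sqrt (h / 2) / ν) σ (x - z) ≤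
      (P * Real.exp (2 * θ ^ 2 * (ν * h) - θ * r)) * (Real.exp (θ * ‖z - x₀‖) * g z) := by
    intro z
    have hk := upperOfMoments_kernel_pointwise hν hC hh hσ1 hσ2 (x - z)
    rw [← hP] at hk
    have htri : r ≤ ‖x - z‖ + ‖z - x₀‖ := by rw [hr]; exact norm_sub_le_norm_sub_add_norm_sub x z x₀
    have hq : θ * ‖x - z‖ ≤ ‖x - z‖ ^ 2 / (8 * (ν * h)) + 2 * θ ^ 2 * (ν * h) := by
      have h8 : (0 : ℝ) < 8 * (ν * h) := by positivity
      rw [div_add' _ _ _ h8.ne', le_div_iff₀ h8]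
      nlinarith [sq_nonneg (‖x - z‖ - 4 * θ * (ν * h))]
    have h1 : Real.exp (-‖x - z‖ ^ 2 / (8 * (ν * h))) ≤
        Real.exp (2 * θ ^ 2 * (ν * h) - θ * r) * Real.exp (θ * ‖z - x₀‖) := by
      rw [← Real.exp_add]
      refine Real.exp_le_exp.2 ?_
      rw [neg_div]
      nlinarith [mul_le_mul_of_nonneg_left htri hθ0]
    calc g z * driftKernel 1 (C / Real.sqrt (h / 2) / ν) σ (x - z)
        ≤ g z * (P * Real.exp (-‖x - z‖ ^ 2 / (8 * (ν * h)))) :=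
          mul_le_mul_of_nonneg_left hk (hg0 z)
      _ ≤ g z * (P * (Real.exp (2 * θ ^ 2 * (ν * h) - θ * r) * Real.exp (θ * ‖z - x₀‖))) :=
          mul_le_mul_of_nonneg_left (mul_le_mul_of_nonneg_left h1 hP0) (hg0 z)
      _ = _ := by ring
  -- the moment of the norm
  obtain ⟨hint, hmomθ⟩ := upperOfMoments_norm_moment
    (Φ := fun s => Real.exp (ν * s ^ 2 * (h / 2) + 2 * C * s * Real.sqrt (h / 2))) hθ0 hg0 hmom
  simp only [hsq] at hmomθ
  -- integrability of the left-hand side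
  have hgi : Integrable g := by
    have h0 := (hmom 0).1
    simp only [inner_zero_left, Real.exp_zero, one_mul] at h0
    exact h0
  have hA0 : 0 ≤ C / Real.sqrt (h / 2) / ν := by positivity
  have hLi : Integrable fun z => g z * driftKernel 1 (C / Real.sqrt (h / 2) / ν) σ (x - z) := by
    have hk : Continuous fun z => driftKernel (E := EuclideanSpace ℝ (Fin 3)) 1
        (C / Real.sqrt (h / 2) / ν) σ (x - z) :=
      (contDiff_driftKernel (N := 0) 1 _ hσ).continuous.comp (by fun_prop)
    refine hgi.mul_bdd (c := kSupTail (Module.finrank ℝ (EuclideanSpace ℝ (Fin 3)))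
      (C / Real.sqrt (h / 2) / ν) 0 σ) hk.aestronglyMeasurable (Eventually.of_forall fun z => ?_)
    rw [Real.norm_of_nonneg (driftKernel_pos 1 _ hσ _).le]
    exact driftKernel_le_kSupTail (by norm_num) hA0 hσ le_rfl (norm_nonneg _)
  -- the exponent bookkeeping with `θ = r/(8νh)`
  have key : 2 * θ ^ 2 * (ν * h) - θ * r + (ν * (2 * θ) ^ 2 * (h / 2) + 2 * C * (2 * θ) * u) ≤
      C ^ 2 / ν + -(r ^ 2) / (32 * ν * h) := by
    have hh2 : h = 2 * u ^ 2 := by linarith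
    have hνh : 0 < ν * h := by positivity
    rw [hθ]
    rw [hh2] at hνh ⊢
    have hden : (0 : ℝ) < 32 * ν * (2 * u ^ 2) := by positivity
    have e : C ^ 2 / ν + -(r ^ 2) / (32 * ν * (2 * u ^ 2)) -
        (2 * (r / (8 * (ν * (2 * u ^ 2)))) ^ 2 * (ν * (2 * u ^ 2)) -
          r / (8 * (ν * (2 * u ^ 2))) * r +
          (ν * (2 * (r / (8 * (ν * (2 * u ^ 2))))) ^ 2 * (2 * u ^ 2 / 2) +
            2 * C * (2 * (r / (8 * (ν * (2 * u ^ 2))))) * u)) =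
        (r - 8 * C * u) ^ 2 / (32 * ν * (2 * u ^ 2)) := by
      field_simp
      ring
    have hnn : 0 ≤ (r - 8 * C * u) ^ 2 / (32 * ν * (2 * u ^ 2)) := by positivity
    linarith
  -- assemble
  have hexp : Real.exp (17 * C ^ 2 / ν + 9 / 2) * Real.exp (2 * θ ^ 2 * (ν * h) - θ * r) *
      Real.exp (ν * (2 * θ) ^ 2 * (h / 2) + 2 * C * (2 * θ) * u) ≤
      Real.exp (18 * C ^ 2 / ν + 9 / 2) * Real.exp (-(r ^ 2) / (32 * ν * h)) := by
    rw [← Real.exp_add, ← Real.exp_add, ← Real.exp_add, mul_div_assoc, mul_div_assoc]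
    exact Real.exp_le_exp.2 (by linarith [key])
  have hQ : 0 ≤ 6 * (2 * π * ν) ^ (-(3:ℝ) / 2) * h ^ (-(3:ℝ) / 2) := by positivity
  calc ∫ z, g z * driftKernel 1 (C / Real.sqrt (h / 2) / ν) σ (x - z)
      ≤ ∫ z, (P * Real.exp (2 * θ ^ 2 * (ν * h) - θ * r)) * (Real.exp (θ * ‖z - x₀‖) * g z) :=
        integral_mono hLi (hint.const_mul _) hpt
    _ = (P * Real.exp (2 * θ ^ 2 * (ν * h) - θ * r)) * ∫ z, Real.exp (θ * ‖z - x₀‖) * g z :=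
        integral_const_mul _ _
    _ ≤ (P * Real.exp (2 * θ ^ 2 * (ν * h) - θ * r)) *
          (6 * Real.exp (ν * (2 * θ) ^ 2 * (h / 2) + 2 * C * (2 * θ) * u)) :=
        mul_le_mul_of_nonneg_left hmomθ (by positivity)
    _ = 6 * (2 * π * ν) ^ (-(3:ℝ) / 2) * h ^ (-(3:ℝ) / 2) *
          (Real.exp (17 * C ^ 2 / ν + 9 / 2) * Real.exp (2 * θ ^ 2 * (ν * h) - θ * r) *
            Real.exp (ν * (2 * θ) ^ 2 * (h / 2) + 2 * C * (2 * θ) * u)) := by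
        rw [hP]; ring
    _ ≤ 6 * (2 * π * ν) ^ (-(3:ℝ) / 2) * h ^ (-(3:ℝ) / 2) *
          (Real.exp (18 * C ^ 2 / ν + 9 / 2) * Real.exp (-(r ^ 2) / (32 * ν * h))) :=
        mul_le_mul_of_nonneg_left hexp hQ
    _ = _ := by rw [hr]; ring

end Summit.NavierStokesRegularity.NavierStokesRegularity.Theorems.AdaptedKernelExists.NashEntropyLastBlock

end
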